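import Summits.NavierStokesRegularity.NavierStokesRegularity.Theorems.FilamentSkeletonRssCoreGluingRouteReduction

/-!
# Crux `CoreGluing` (stmt-NavierStokesRegularity-15401) — typed restatement menu (lead c3, line `Sketch` dead)

Evidence file (NOT a proposal).  R1 below is the honest content of the crux once its idle hypothesis is
dropped; every arrow out of it is ALREADY a tree theorem (p130189, p134409).  R2 (a genuine gluing pair)
is specified in the docstring of `R2_spec` only: designing the quantitative skeleton predicate is the
planner's call (c2's `Recut-c2.lean`, evidence on this item, has a typed candidate `SkeletonFamilyAt`).
-/

set_option linter.dupNamespace false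

noncomputable section

namespace Summit.NavierStokesRegularity.NavierStokesRegularity.Cruxes.CoreGluing.Restatement

open Summit.NavierStokesRegularity.NavierStokesRegularity.Theses.FilamentSkeletonRss
open Summit.NavierStokesRegularity.NavierStokesRegularity.Theorems
open Literature.Analysis.FluidPDE Literature.Analysis.FluidPDE.PineauVicol2026
open scoped Laplacian ContDiff

/-- A smooth nontrivial rotated Leray profile at angular speed `α` with profile Type-I decay and bounded
pressure (Pineau–Vicol 2026, (1.8)); verbatim the conclusion of the dead line's open stub at a GIVEN `α`. -/
def ProfileExistsAt (α : ℝ) : Prop :=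
  ∃ (C₀ M : ℝ) (U : EuclideanSpace ℝ (Fin 3) → EuclideanSpace ℝ (Fin 3)) (P : EuclideanSpace ℝ (Fin 3) → ℝ),
    U ≠ 0 ∧ ContDiff ℝ (⊤ : ℕ∞) U ∧ ContDiff ℝ (⊤ : ℕ∞) P ∧ VectorCalculus.IsDivFree U ∧
    (∀ y : EuclideanSpace ℝ (Fin 3), α • (rotGen (U y) - fderiv ℝ U y (rotGen y)) + (1 / 2 : ℝ) • U y +
      (1 / 2 : ℝ) • fderiv ℝ U y y - (Δ U) y + fderiv ℝ U y (U y) + gradient P y = 0) ∧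
    (∀ y : EuclideanSpace ℝ (Fin 3), ‖U y‖ ≤ C₀ / (1 + ‖y‖)) ∧
    (∀ y : EuclideanSpace ℝ (Fin 3), |P y| ≤ M)

/-- **R1** — the crux in PDE form (what `CoreGluing` owes once `SkeletonEquilibrium` is discharged). -/
def CoreGluingPDE : Prop := ∃ α : ℝ, α ≠ 0 ∧ ProfileExistsAt α

/-- R1 gives the route target (tree: `stub_rssProfileExists_of_profile`, p130189). -/
theorem rssProfileExists_of_coreGluingPDE (h : CoreGluingPDE) : RssProfileExists := by
  obtain ⟨α, hα, C₀, M, U, P, hU0, hU, hP, hdiv, heq, hdec, hPM⟩ := h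
  exact stub_rssProfileExists_of_profile ⟨α, C₀, M, U, P, hα, hU0, hU, hP, hdiv, heq, hdec, hPM⟩

/-- R1 gives the crux as filed (its hypothesis goes unused). -/
theorem coreGluing_of_coreGluingPDE (h : CoreGluingPDE) : CoreGluing :=
  fun _ => rssProfileExists_of_coreGluingPDE h

/-- R1 alone decides the summit (tree: `rssProfileExists_not_navierStokesRegularity`, p134409). -/
theorem not_navierStokesRegularity_of_coreGluingPDE (h : CoreGluingPDE) : ¬ _root_.NavierStokesRegularity :=
  rssProfileExists_not_navierStokesRegularity (rssProfileExists_of_coreGluingPDE h)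

/-- Conversely the filed crux yields R1's consequence only THROUGH K1: `SkeletonEquilibrium → CoreGluing →
RssProfileExists` (so, as filed, K2 is "K1 → target"). -/
theorem rssProfileExists_of_coreGluing (hK1 : SkeletonEquilibrium) (hK2 : CoreGluing) : RssProfileExists :=
  hK2 hK1

/-- **R2 (specification only).**  A gluing PAIR that makes the split real must read
`K1q α → ProfileExistsAt α` for the SAME `α`, with `K1q α` exporting, for ALL `Γ ≥ Γ₀` (not along a
sequence): (i) the clauses of `SkeletonEquilibrium` at that `α`; (ii) Γ-uniform `C^{2,β}` bounds on
`(Ξ_j/√Γ, w_j/√Γ)` in waist units and a Γ-uniform window `3/2 + δ ≤ w_j′ ≤ Λ` near `τ*`; (iii) transverse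
confinement at each stagnation core: the linearisation `A_⊥` of the skeleton field across the filament at
`τ*` is Hurwitz, `det A_⊥ = μ₁ μ₂ + α² ⟨Ξ_j′(τ*), e₃⟩² > 0`, `tr A_⊥ < 0` (c2 audit: 2001 C₃ det −2.38 ✗,
sibling K1 datum −0.022 ✗, D* +0.277 ✓); (iv) non-degeneracy of the linearised tangency map modulo
rotation about `e₃` in a weighted space along the spiral ends; (v) an `N`-parameter transversal family
(circulation ratios / α) unfolding the `N` zero-accretion (slice-mass) scalars (p129880, p130322).  Even so
R2's K2q is an open 3-D gluing problem (strain/rotation ratio O(1) at the cores; no analogue in print). -/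
def R2_spec : Prop := True

end Summit.NavierStokesRegularity.NavierStokesRegularity.Cruxes.CoreGluing.Restatement

end
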